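/-
Copyright: the b2b-balaban T⁴-continuum CRUX team, row NE7b OWNER lineage `t4-ne7b-p1` (gen 144). Project licence.
-/
import Summits.QuantumFields.BalabanUV.T4Continuum.Spine.NE7b.SupWhitenedFifthKernelLetter
import Summits.QuantumFields.BalabanUV.T4Continuum.Spine.NE7b.SupFiniteRangeFourthCumulant
import Summits.QuantumFields.BalabanUV.T4Continuum.Spine.NE7b.SupThirdDerivativeVectorGeometryLetters

/-!
# THE ORDER-FIVE KERNEL LETTER FOR A FINITE-RANGE FACTOR (SCOPING (d15′)(vi); the order-5 analogue of (524)): (600) with the weights,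
# the admissible `D` and the three profiles DISCHARGED for placements `p : ι → X`, `q : κ → X`, a rate `μ ≥ 0`, a factor of range `R` and
# majorants `Hk, K3, K4` of ranges `R′, R₃, R₄` in their last slot: `θ = e^{8μd(q,q)}`, `σ = e^{8μd(p,q)}`, `ρ = e^{μd(p,p)}`, `r = e^{(μ∕3)d(p,p)}`,
# `D` the Neumann series of the whitened Dobrushin matrix, `dr := dθ ≥ (1−γθ)⁻¹`, `dc := dθ′ ≥ (1−γθ′)⁻¹`, ONE profile letter
# `αθ ≥ e^{8μ(R+R′)}hr·αr + e^{8μ(R+R₃)}αr·k3e + e^{8μ(R+R₄)}αr·k4e` for all three profiles ((602) for the `K4`-vector).  Hypotheses left: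
# class letters, plain factor letters, the weighted SMALLNESS `γθ, γθ′ < 1`, the letters `dθ, dθ′, αθ`, the site letters `S, S′, S₁`, the
# support counts `n, n₃` (row NE7b, node U5c; (600), (476), (499), (510), (485), (602) BY NAME; [folklore])

Cell `pub-balaban`, sub-cell `t4`, spine estimate NE7b (`T4WeightBudget.RelWeightBound`; the cell's OWN estimate — NOT PRINTED in
[Bałaban 1983–89], NOT PROVED).  Crux-route work under `Spine/NE7b/` by the row OWNER (`t4-ne7b-p1` gen 144, file (601)) under FREEZE
(0)'s crux-prover clause; NOTHING of Bałaban's is named as a Lean object, valued or asserted; no `T4Continuum/Support` leaf typed; no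
`def`, no notation; zero `sorry`.  Imports (BY NAME): the OWNER's (600), (499) ((476), (485) through it), (602).

WHAT IS PROVED ([folklore]): THE END **`finite_range_fifth_kernel_letter`**; toy.

HONEST (what this is NOT).  An instantiation; site letters and support counts are properties of the lattice placement (NOT typed), the
weighted smallness is a condition on `μ·range` and the Dobrushin constant; the class-map block and `C⁵` packaging are NOT typed.  Scalar skeleton
((A3), NC-NE7b-α UNRULED); nothing of
Bałaban's asserted.  BY-NAME EFFECT ON THE WALL: NONE.  NE7b NOT PRINTED ∕ NOT PROVED; spine PROVED 0∕9; rung (B)+1 — the programme's measures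
remain FINITE-torus statements; NOT the mass gap, NOT Clay.  HONEST DEPENDENCY: continuum YM on T⁴ ⇐ BetaPertH ∧ nine spine estimates (0∕9
proved); BetaPertH ⇐ (D1) ∧ (D4) ∧ CAP+tail; G-an2-4 gates asym, D1 and NE2∕3∕4.
-/

set_option autoImplicit false
set_option maxSynthPendingDepth 4

noncomputable section

namespace Summit.QuantumFields.BalabanUV.T4Continuum.NE7b.SupFiniteRangeFifthKernelLetter

open MeasureTheory ProbabilityTheory Finset Real Matrix
open scoped BigOperators Matrix
open SupWhitenedFifthKernelLetter (whitened_fifth_kernel_letter)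
open SupFiniteRangeGeometryLetters (expw_one_le expw_diag expw_triangle rho_pow_eight_le sigma_theta weighted_cross_rowsum_le
  weighted_cross_colsum_le weighted_obs_rowsum_le weighted_obs_entry_le)
open SupFiniteRangeFourthCumulant (r_pow_24_le)
open SupHessianVectorGeometryLetters (weighted_hess_rowsum_le weighted_hess_entry_le)
open SupThirdDerivativeVectorGeometryLetters (weighted_third4_rowsum_le weighted_third4_entry_le)
open SupWhitenedNeumannAdmissible (neumannD_nonneg neumannD_dominates neumannD_weighted_rowsum neumannD_weighted_colsum)

variable {ι κ X : Type} [Fintype ι] [DecidableEq ι] [Fintype κ] [DecidableEq κ] [PseudoMetricSpace X]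

/-! ## §1. THE END: the order-five kernel letter for a finite-range factor -/

section TheEnd

variable {U : EuclideanSpace ℝ ι → ℝ} {U' : EuclideanSpace ℝ ι → EuclideanSpace ℝ ι →L[ℝ] ℝ}
  {U'' : EuclideanSpace ℝ ι → EuclideanSpace ℝ ι →L[ℝ] EuclideanSpace ℝ ι →L[ℝ] ℝ}
  {U₃ : EuclideanSpace ℝ ι → EuclideanSpace ℝ ι →L[ℝ] EuclideanSpace ℝ ι →L[ℝ] EuclideanSpace ℝ ι →L[ℝ] ℝ}
  {U₄ : EuclideanSpace ℝ ι → EuclideanSpace ℝ ι →L[ℝ] EuclideanSpace ℝ ι →L[ℝ] EuclideanSpace ℝ ι →L[ℝ] EuclideanSpace ℝ ι →L[ℝ] ℝ}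
  {U₅ : EuclideanSpace ℝ ι →
    EuclideanSpace ℝ ι →L[ℝ] EuclideanSpace ℝ ι →L[ℝ] EuclideanSpace ℝ ι →L[ℝ] EuclideanSpace ℝ ι →L[ℝ] EuclideanSpace ℝ ι →L[ℝ] ℝ}
  {Hk : ι → ι → ℝ} {K3 : ι → ι → ι → ℝ} {K4 : ι → ι → ι → ι → ℝ} {K5 : ι → ι → ι → ι → ι → ℝ} {A : Matrix ι κ ℝ} {D : κ → κ → ℝ}
  {γop κ₀ κ₁ κ₂ κ₃ κ₄ κ₅ κ₅r a τ δ θp lam lamA αr αc hr hc k3r k3c k4r k4c k5r k5c γ dθ dθ' αθ S S' S₁ n₃ : ℝ}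
  {p : ι → X} {q : κ → X} {μ R R' R₃ R₄ k3e k4e : ℝ} {n : ℕ}

set_option synthInstance.maxHeartbeats 200000 in
set_option maxHeartbeats 800000 in
/-- **THE END — THE ORDER-FIVE KERNEL LETTER FOR A FINITE-RANGE FACTOR**: (600) with the weights, the admissible `D` and the profiles
instantiated; hypotheses beyond the class∕factor letters: `μ ≥ 0`, the ranges, `γθ, γθ′ < 1`, `dθ ≥ (1−γθ)⁻¹`, `dθ′ ≥ (1−γθ′)⁻¹`, the
profile letter `αθ`, the site letters `S, S′, S₁`, the support counts `n, n₃`. [folklore] -/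
theorem finite_range_fifth_kernel_letter [Nonempty κ]
    (hΓop : (γop • (1 : Matrix ι ι ℝ) - A * Aᵀ).PosSemidef) (Y : Finset ι) (hUd : ∀ φ : EuclideanSpace ℝ ι, HasFDerivAt U (U' φ) φ)
    (hU'd : ∀ φ : EuclideanSpace ℝ ι, HasFDerivAt U' (U'' φ) φ) (hU''d : ∀ φ : EuclideanSpace ℝ ι, HasFDerivAt U'' (U₃ φ) φ)
    (hU₃d : ∀ φ : EuclideanSpace ℝ ι, HasFDerivAt U₃ (U₄ φ) φ) (hU₄d : ∀ φ : EuclideanSpace ℝ ι, HasFDerivAt U₄ (U₅ φ) φ) (hU₅c : Continuous U₅)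
    (hκ₀ : 0 ≤ κ₀) (hκ₁ : 0 ≤ κ₁) (ha : 0 ≤ a) (hτ : 0 < τ) (hδ : 0 < δ) (hθ0 : 0 < θp) (hθ1 : θp < 1) (hκθ : (2 * κ₀ * (1 + τ) + 4 * δ) * γop ≤ θp)
    (hκθw : 2 * κ₀ * (1 + τ) * γop + 4 * δ ≤ θp) (hstab : ∀ φ : EuclideanSpace ℝ ι, -(κ₀ * ∑ x ∈ Y, φ x ^ 2) ≤ U φ)
    (hU'b : ∀ φ : EuclideanSpace ℝ ι, ‖U' φ‖ ≤ κ₁ * (a + ∑ x ∈ Y, φ x ^ 2)) (hU''b : ∀ φ : EuclideanSpace ℝ ι, ‖U'' φ‖ ≤ κ₂)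
    (hU₃b : ∀ φ : EuclideanSpace ℝ ι, ‖U₃ φ‖ ≤ κ₃) (hU₄b : ∀ φ : EuclideanSpace ℝ ι, ‖U₄ φ‖ ≤ κ₄) (hU₅b : ∀ φ : EuclideanSpace ℝ ι, ‖U₅ φ‖ ≤ κ₅)
    (hlam : 0 ≤ lam)
    (hUsec : ∀ s : ℝ, 0 ≤ s → s ≤ 1 → ∀ a b : EuclideanSpace ℝ ι,
      U ((1 - s) • a + s • b) - lam / 2 * (s * (1 - s)) * ∑ i, (a i - b i) ^ 2 ≤ (1 - s) * U a + s * U b)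
    (hρg : lam * γop < 1)
    (hHk : ∀ (φ : EuclideanSpace ℝ ι) (x z : ι), |U'' φ (EuclideanSpace.single z (1 : ℝ)) (EuclideanSpace.single x (1 : ℝ))| ≤ Hk x z)
    (hHk0 : ∀ v u, 0 ≤ Hk v u)
    (hK3 : ∀ (φ : EuclideanSpace ℝ ι) (u x y : ι),
      |U₃ φ (EuclideanSpace.single u (1 : ℝ)) (EuclideanSpace.single x (1 : ℝ)) (EuclideanSpace.single y (1 : ℝ))| ≤ K3 x y u)
    (hK30 : ∀ x y u, 0 ≤ K3 x y u)
    (hK4 : ∀ (φ : EuclideanSpace ℝ ι) (u x y z : ι), |U₄ φ (EuclideanSpace.single u (1 : ℝ)) (EuclideanSpace.single x (1 : ℝ))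
      (EuclideanSpace.single y (1 : ℝ)) (EuclideanSpace.single z (1 : ℝ))| ≤ K4 x y z u)
    (hK40 : ∀ x y z u, 0 ≤ K4 x y z u)
    (hK5 : ∀ (φ : EuclideanSpace ℝ ι) (u x y z t : ι), |U₅ φ (EuclideanSpace.single u (1 : ℝ)) (EuclideanSpace.single x (1 : ℝ))
      (EuclideanSpace.single y (1 : ℝ)) (EuclideanSpace.single z (1 : ℝ)) (EuclideanSpace.single t (1 : ℝ))| ≤ K5 x y z t u)
    (hK50 : ∀ x y z t u, 0 ≤ K5 x y z t u)
    (hU₅row : ∀ (φ : EuclideanSpace ℝ ι) (x : ι), ∑ y, ∑ z, ∑ t, ∑ s, |U₅ φ (EuclideanSpace.single x (1 : ℝ)) (EuclideanSpace.single y (1 : ℝ))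
      (EuclideanSpace.single z (1 : ℝ)) (EuclideanSpace.single t (1 : ℝ)) (EuclideanSpace.single s (1 : ℝ))| ≤ κ₅r)
    (hhr : ∀ v, ∑ u, Hk v u ≤ hr) (hhc : ∀ u, ∑ v, Hk v u ≤ hc) (hk3r : ∀ x, ∑ y, ∑ u, K3 x y u ≤ k3r) (hk3c : ∀ u, ∑ y, ∑ z, K3 y z u ≤ k3c)
    (hk3e : ∀ x y, ∑ u, K3 x y u ≤ k3e) (hk4r : ∀ x, ∑ y, ∑ z, ∑ u, K4 x y z u ≤ k4r) (hk4c : ∀ u, ∑ y, ∑ z, ∑ t, K4 y z t u ≤ k4c)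
    (hk4e : ∀ x y z, ∑ u, K4 x y z u ≤ k4e) (hk5r : ∀ x, ∑ y, ∑ z, ∑ t, ∑ u, K5 x y z t u ≤ k5r) (hk5c : ∀ u, ∑ y, ∑ z, ∑ t, ∑ s, K5 y z t s u ≤ k5c)
    (ψ : EuclideanSpace ℝ ι) (hαr : ∀ u, ∑ w, |A u w| ≤ αr) (hαc : ∀ w, ∑ u, |A u w| ≤ αc)
    (hlamA : ∀ x : κ, ∑ u, ∑ v, |A u x| * |A v x| * Hk v u ≤ lamA) (hlamA1 : lamA < 1) (hγ : αc * hr * αr / (1 - lamA) ≤ γ) (hγ1 : γ < 1) (hμ : 0 ≤ μ)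
    (hAR : ∀ u w, A u w = 0 ∨ dist (p u) (q w) ≤ R) (hHkR : ∀ v u, Hk v u = 0 ∨ dist (p v) (p u) ≤ R')
    (hK3R : ∀ x y u, K3 x y u = 0 ∨ dist (p x) (p u) ≤ R₃) (hK4R : ∀ x y z u, K4 x y z u = 0 ∨ dist (p x) (p u) ≤ R₄)
    (hγθ1 : Real.exp (8 * μ * (2 * R + R')) * (αc * hr * αr) / (1 - lamA) < 1)
    (hγθ'1 : Real.exp (8 * μ * (2 * R + R')) * (αc * hc * αr) / (1 - lamA)
        < 1)
    (hdθ : (1 - (Real.exp (8 * μ * (2 * R + R')) * (αc * hr * αr) / (1 - lamA)))⁻¹ ≤ dθ)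
    (hdθ' : (1 - (Real.exp (8 * μ * (2 * R + R')) * (αc * hc * αr) / (1 - lamA)))⁻¹ ≤ dθ')
    (hαθ : Real.exp (8 * μ * (R + R')) * (hr * αr) + Real.exp (8 * μ * (R + R₃)) * (αr * k3e) + Real.exp (8 * μ * (R + R₄)) * (αr * k4e) ≤ αθ) (x : ι)
    (hS : ∑ y, 1 / Real.exp (μ * dist (p x) (p y)) ≤ S) (hS' : ∀ u, ∑ v, (Real.exp (μ / 3 * dist (p u) (p v)) ^ 2)⁻¹ ≤ S')
    (hS1 : ∀ u, ∑ v, (Real.exp (μ / 3 * dist (p u) (p v)))⁻¹ ≤ S₁) (hn : ∀ y : ι, (Finset.univ.filter (fun z => Hk z y ≠ 0)).card ≤ n)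
    (hn3 : ∀ y : ι, ∑ z, ((Finset.univ.filter (fun t => K3 z t y ≠ 0)).card : ℝ) ≤ n₃) :
    ∑ y, ∑ z, ∑ t, ∑ s, |lineDeriv ℝ (fun ψ' : EuclideanSpace ℝ ι => (∫ ω : EuclideanSpace ℝ ι, exp (-U (ω + ψ')) ∂(multivariateGaussian 0 (A *
        Aᵀ)))⁻¹ * (∫ ω : EuclideanSpace ℝ ι, exp (-U (ω + ψ')) * U₄ (ω + ψ') (EuclideanSpace.single y (1 : ℝ)) (EuclideanSpace.single z (1 : ℝ))
        (EuclideanSpace.single t (1 : ℝ)) (EuclideanSpace.single s (1 : ℝ)) ∂(multivariateGaussian 0 (A * Aᵀ))) -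
        (((∫ ω : EuclideanSpace ℝ ι, exp (-U (ω + ψ')) ∂(multivariateGaussian 0 (A * Aᵀ)))⁻¹ * (∫ ω : EuclideanSpace ℝ ι, exp (-U (ω + ψ')) * (U₃ (ω
            + ψ') (EuclideanSpace.single y (1 : ℝ)) (EuclideanSpace.single t (1 : ℝ)) (EuclideanSpace.single s (1 : ℝ)) * U' (ω + ψ')
            (EuclideanSpace.single z (1 : ℝ))) ∂(multivariateGaussian 0 (A * Aᵀ))) - ((∫ ω : EuclideanSpace ℝ ι, exp (-U (ω + ψ'))
            ∂(multivariateGaussian 0 (A * Aᵀ))) ^ 2)⁻¹ * ((∫ ω : EuclideanSpace ℝ ι, exp (-U (ω + ψ')) * U₃ (ω + ψ') (EuclideanSpace.single y (1 :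
            ℝ)) (EuclideanSpace.single t (1 : ℝ)) (EuclideanSpace.single s (1 : ℝ)) ∂(multivariateGaussian 0 (A * Aᵀ))) * (∫ ω : EuclideanSpace ℝ ι,
            exp (-U (ω + ψ')) * U' (ω + ψ') (EuclideanSpace.single z (1 : ℝ)) ∂(multivariateGaussian 0 (A * Aᵀ))))) + ((∫ ω : EuclideanSpace ℝ ι, exp
            (-U (ω + ψ')) ∂(multivariateGaussian 0 (A * Aᵀ)))⁻¹ * (∫ ω : EuclideanSpace ℝ ι, exp (-U (ω + ψ')) * (U₃ (ω + ψ') (EuclideanSpace.single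
            y (1 : ℝ)) (EuclideanSpace.single z (1 : ℝ)) (EuclideanSpace.single s (1 : ℝ)) * U' (ω + ψ') (EuclideanSpace.single t (1 : ℝ)))
            ∂(multivariateGaussian 0 (A * Aᵀ))) - ((∫ ω : EuclideanSpace ℝ ι, exp (-U (ω + ψ')) ∂(multivariateGaussian 0 (A * Aᵀ))) ^ 2)⁻¹ * ((∫ ω :
            EuclideanSpace ℝ ι, exp (-U (ω + ψ')) * U₃ (ω + ψ') (EuclideanSpace.single y (1 : ℝ)) (EuclideanSpace.single z (1 : ℝ))
            (EuclideanSpace.single s (1 : ℝ)) ∂(multivariateGaussian 0 (A * Aᵀ))) * (∫ ω : EuclideanSpace ℝ ι, exp (-U (ω + ψ')) * U' (ω + ψ')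
            (EuclideanSpace.single t (1 : ℝ)) ∂(multivariateGaussian 0 (A * Aᵀ))))) + ((∫ ω : EuclideanSpace ℝ ι, exp (-U (ω + ψ'))
            ∂(multivariateGaussian 0 (A * Aᵀ)))⁻¹ * (∫ ω : EuclideanSpace ℝ ι, exp (-U (ω + ψ')) * (U₃ (ω + ψ') (EuclideanSpace.single y (1 : ℝ))
            (EuclideanSpace.single z (1 : ℝ)) (EuclideanSpace.single t (1 : ℝ)) * U' (ω + ψ') (EuclideanSpace.single s (1 : ℝ)))
            ∂(multivariateGaussian 0 (A * Aᵀ))) - ((∫ ω : EuclideanSpace ℝ ι, exp (-U (ω + ψ')) ∂(multivariateGaussian 0 (A * Aᵀ))) ^ 2)⁻¹ * ((∫ ω :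
            EuclideanSpace ℝ ι, exp (-U (ω + ψ')) * U₃ (ω + ψ') (EuclideanSpace.single y (1 : ℝ)) (EuclideanSpace.single z (1 : ℝ))
            (EuclideanSpace.single t (1 : ℝ)) ∂(multivariateGaussian 0 (A * Aᵀ))) * (∫ ω : EuclideanSpace ℝ ι, exp (-U (ω + ψ')) * U' (ω + ψ')
            (EuclideanSpace.single s (1 : ℝ)) ∂(multivariateGaussian 0 (A * Aᵀ))))) + ((∫ ω : EuclideanSpace ℝ ι, exp (-U (ω + ψ'))
            ∂(multivariateGaussian 0 (A * Aᵀ)))⁻¹ * (∫ ω : EuclideanSpace ℝ ι, exp (-U (ω + ψ')) * (U' (ω + ψ') (EuclideanSpace.single y (1 : ℝ)) *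
            U₃ (ω + ψ') (EuclideanSpace.single z (1 : ℝ)) (EuclideanSpace.single t (1 : ℝ)) (EuclideanSpace.single s (1 : ℝ))) ∂(multivariateGaussian
            0 (A * Aᵀ))) - ((∫ ω : EuclideanSpace ℝ ι, exp (-U (ω + ψ')) ∂(multivariateGaussian 0 (A * Aᵀ))) ^ 2)⁻¹ * ((∫ ω : EuclideanSpace ℝ ι, exp
            (-U (ω + ψ')) * U' (ω + ψ') (EuclideanSpace.single y (1 : ℝ)) ∂(multivariateGaussian 0 (A * Aᵀ))) * (∫ ω : EuclideanSpace ℝ ι, exp (-U (ω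
            + ψ')) * U₃ (ω + ψ') (EuclideanSpace.single z (1 : ℝ)) (EuclideanSpace.single t (1 : ℝ)) (EuclideanSpace.single s (1 : ℝ))
            ∂(multivariateGaussian 0 (A * Aᵀ)))))) -
        (((∫ ω : EuclideanSpace ℝ ι, exp (-U (ω + ψ')) ∂(multivariateGaussian 0 (A * Aᵀ)))⁻¹ * (∫ ω : EuclideanSpace ℝ ι, exp (-U (ω + ψ')) * (U'' (ω
            + ψ') (EuclideanSpace.single y (1 : ℝ)) (EuclideanSpace.single z (1 : ℝ)) * U'' (ω + ψ') (EuclideanSpace.single t (1 : ℝ))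
            (EuclideanSpace.single s (1 : ℝ))) ∂(multivariateGaussian 0 (A * Aᵀ))) - ((∫ ω : EuclideanSpace ℝ ι, exp (-U (ω + ψ'))
            ∂(multivariateGaussian 0 (A * Aᵀ))) ^ 2)⁻¹ * ((∫ ω : EuclideanSpace ℝ ι, exp (-U (ω + ψ')) * U'' (ω + ψ') (EuclideanSpace.single y (1 :
            ℝ)) (EuclideanSpace.single z (1 : ℝ)) ∂(multivariateGaussian 0 (A * Aᵀ))) * (∫ ω : EuclideanSpace ℝ ι, exp (-U (ω + ψ')) * U'' (ω + ψ')
            (EuclideanSpace.single t (1 : ℝ)) (EuclideanSpace.single s (1 : ℝ)) ∂(multivariateGaussian 0 (A * Aᵀ))))) + ((∫ ω : EuclideanSpace ℝ ι,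
            exp (-U (ω + ψ')) ∂(multivariateGaussian 0 (A * Aᵀ)))⁻¹ * (∫ ω : EuclideanSpace ℝ ι, exp (-U (ω + ψ')) * (U'' (ω + ψ')
            (EuclideanSpace.single y (1 : ℝ)) (EuclideanSpace.single t (1 : ℝ)) * U'' (ω + ψ') (EuclideanSpace.single z (1 : ℝ))
            (EuclideanSpace.single s (1 : ℝ))) ∂(multivariateGaussian 0 (A * Aᵀ))) - ((∫ ω : EuclideanSpace ℝ ι, exp (-U (ω + ψ'))
            ∂(multivariateGaussian 0 (A * Aᵀ))) ^ 2)⁻¹ * ((∫ ω : EuclideanSpace ℝ ι, exp (-U (ω + ψ')) * U'' (ω + ψ') (EuclideanSpace.single y (1 :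
            ℝ)) (EuclideanSpace.single t (1 : ℝ)) ∂(multivariateGaussian 0 (A * Aᵀ))) * (∫ ω : EuclideanSpace ℝ ι, exp (-U (ω + ψ')) * U'' (ω + ψ')
            (EuclideanSpace.single z (1 : ℝ)) (EuclideanSpace.single s (1 : ℝ)) ∂(multivariateGaussian 0 (A * Aᵀ))))) + ((∫ ω : EuclideanSpace ℝ ι,
            exp (-U (ω + ψ')) ∂(multivariateGaussian 0 (A * Aᵀ)))⁻¹ * (∫ ω : EuclideanSpace ℝ ι, exp (-U (ω + ψ')) * (U'' (ω + ψ')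
            (EuclideanSpace.single y (1 : ℝ)) (EuclideanSpace.single s (1 : ℝ)) * U'' (ω + ψ') (EuclideanSpace.single z (1 : ℝ))
            (EuclideanSpace.single t (1 : ℝ))) ∂(multivariateGaussian 0 (A * Aᵀ))) - ((∫ ω : EuclideanSpace ℝ ι, exp (-U (ω + ψ'))
            ∂(multivariateGaussian 0 (A * Aᵀ))) ^ 2)⁻¹ * ((∫ ω : EuclideanSpace ℝ ι, exp (-U (ω + ψ')) * U'' (ω + ψ') (EuclideanSpace.single y (1 :
            ℝ)) (EuclideanSpace.single s (1 : ℝ)) ∂(multivariateGaussian 0 (A * Aᵀ))) * (∫ ω : EuclideanSpace ℝ ι, exp (-U (ω + ψ')) * U'' (ω + ψ')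
            (EuclideanSpace.single z (1 : ℝ)) (EuclideanSpace.single t (1 : ℝ)) ∂(multivariateGaussian 0 (A * Aᵀ)))))) +
        ((∫ ω : EuclideanSpace ℝ ι, exp (-U (ω + ψ')) ∂(multivariateGaussian 0 (A * Aᵀ)))⁻¹ * (∫ ω : EuclideanSpace ℝ ι, exp (-U (ω + ψ')) * ((U'' (ω
            + ψ') (EuclideanSpace.single y (1 : ℝ)) (EuclideanSpace.single z (1 : ℝ)) - ((∫ ω : EuclideanSpace ℝ ι, exp (-U (ω + ψ'))
            ∂(multivariateGaussian 0 (A * Aᵀ)))⁻¹ * (∫ ω : EuclideanSpace ℝ ι, exp (-U (ω + ψ')) * U'' (ω + ψ') (EuclideanSpace.single y (1 : ℝ))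
            (EuclideanSpace.single z (1 : ℝ)) ∂(multivariateGaussian 0 (A * Aᵀ))))) * (U' (ω + ψ') (EuclideanSpace.single t (1 : ℝ)) - ((∫ ω :
            EuclideanSpace ℝ ι, exp (-U (ω + ψ')) ∂(multivariateGaussian 0 (A * Aᵀ)))⁻¹ * (∫ ω : EuclideanSpace ℝ ι, exp (-U (ω + ψ')) * U' (ω + ψ')
            (EuclideanSpace.single t (1 : ℝ)) ∂(multivariateGaussian 0 (A * Aᵀ))))) * (U' (ω + ψ') (EuclideanSpace.single s (1 : ℝ)) - ((∫ ω :
            EuclideanSpace ℝ ι, exp (-U (ω + ψ')) ∂(multivariateGaussian 0 (A * Aᵀ)))⁻¹ * (∫ ω : EuclideanSpace ℝ ι, exp (-U (ω + ψ')) * U' (ω + ψ')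
            (EuclideanSpace.single s (1 : ℝ)) ∂(multivariateGaussian 0 (A * Aᵀ)))))) ∂(multivariateGaussian 0 (A * Aᵀ))) + (∫ ω : EuclideanSpace ℝ ι,
            exp (-U (ω + ψ')) ∂(multivariateGaussian 0 (A * Aᵀ)))⁻¹ * (∫ ω : EuclideanSpace ℝ ι, exp (-U (ω + ψ')) * ((U'' (ω + ψ')
            (EuclideanSpace.single y (1 : ℝ)) (EuclideanSpace.single t (1 : ℝ)) - ((∫ ω : EuclideanSpace ℝ ι, exp (-U (ω + ψ'))
            ∂(multivariateGaussian 0 (A * Aᵀ)))⁻¹ * (∫ ω : EuclideanSpace ℝ ι, exp (-U (ω + ψ')) * U'' (ω + ψ') (EuclideanSpace.single y (1 : ℝ))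
            (EuclideanSpace.single t (1 : ℝ)) ∂(multivariateGaussian 0 (A * Aᵀ))))) * (U' (ω + ψ') (EuclideanSpace.single z (1 : ℝ)) - ((∫ ω :
            EuclideanSpace ℝ ι, exp (-U (ω + ψ')) ∂(multivariateGaussian 0 (A * Aᵀ)))⁻¹ * (∫ ω : EuclideanSpace ℝ ι, exp (-U (ω + ψ')) * U' (ω + ψ')
            (EuclideanSpace.single z (1 : ℝ)) ∂(multivariateGaussian 0 (A * Aᵀ))))) * (U' (ω + ψ') (EuclideanSpace.single s (1 : ℝ)) - ((∫ ω :
            EuclideanSpace ℝ ι, exp (-U (ω + ψ')) ∂(multivariateGaussian 0 (A * Aᵀ)))⁻¹ * (∫ ω : EuclideanSpace ℝ ι, exp (-U (ω + ψ')) * U' (ω + ψ')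
            (EuclideanSpace.single s (1 : ℝ)) ∂(multivariateGaussian 0 (A * Aᵀ)))))) ∂(multivariateGaussian 0 (A * Aᵀ))) + (∫ ω : EuclideanSpace ℝ ι,
            exp (-U (ω + ψ')) ∂(multivariateGaussian 0 (A * Aᵀ)))⁻¹ * (∫ ω : EuclideanSpace ℝ ι, exp (-U (ω + ψ')) * ((U'' (ω + ψ')
            (EuclideanSpace.single y (1 : ℝ)) (EuclideanSpace.single s (1 : ℝ)) - ((∫ ω : EuclideanSpace ℝ ι, exp (-U (ω + ψ'))
            ∂(multivariateGaussian 0 (A * Aᵀ)))⁻¹ * (∫ ω : EuclideanSpace ℝ ι, exp (-U (ω + ψ')) * U'' (ω + ψ') (EuclideanSpace.single y (1 : ℝ))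
            (EuclideanSpace.single s (1 : ℝ)) ∂(multivariateGaussian 0 (A * Aᵀ))))) * (U' (ω + ψ') (EuclideanSpace.single z (1 : ℝ)) - ((∫ ω :
            EuclideanSpace ℝ ι, exp (-U (ω + ψ')) ∂(multivariateGaussian 0 (A * Aᵀ)))⁻¹ * (∫ ω : EuclideanSpace ℝ ι, exp (-U (ω + ψ')) * U' (ω + ψ')
            (EuclideanSpace.single z (1 : ℝ)) ∂(multivariateGaussian 0 (A * Aᵀ))))) * (U' (ω + ψ') (EuclideanSpace.single t (1 : ℝ)) - ((∫ ω :
            EuclideanSpace ℝ ι, exp (-U (ω + ψ')) ∂(multivariateGaussian 0 (A * Aᵀ)))⁻¹ * (∫ ω : EuclideanSpace ℝ ι, exp (-U (ω + ψ')) * U' (ω + ψ')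
            (EuclideanSpace.single t (1 : ℝ)) ∂(multivariateGaussian 0 (A * Aᵀ)))))) ∂(multivariateGaussian 0 (A * Aᵀ))) + (∫ ω : EuclideanSpace ℝ ι,
            exp (-U (ω + ψ')) ∂(multivariateGaussian 0 (A * Aᵀ)))⁻¹ * (∫ ω : EuclideanSpace ℝ ι, exp (-U (ω + ψ')) * ((U' (ω + ψ')
            (EuclideanSpace.single y (1 : ℝ)) - ((∫ ω : EuclideanSpace ℝ ι, exp (-U (ω + ψ')) ∂(multivariateGaussian 0 (A * Aᵀ)))⁻¹ * (∫ ω :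
            EuclideanSpace ℝ ι, exp (-U (ω + ψ')) * U' (ω + ψ') (EuclideanSpace.single y (1 : ℝ)) ∂(multivariateGaussian 0 (A * Aᵀ))))) * (U'' (ω +
            ψ') (EuclideanSpace.single z (1 : ℝ)) (EuclideanSpace.single t (1 : ℝ)) - ((∫ ω : EuclideanSpace ℝ ι, exp (-U (ω + ψ'))
            ∂(multivariateGaussian 0 (A * Aᵀ)))⁻¹ * (∫ ω : EuclideanSpace ℝ ι, exp (-U (ω + ψ')) * U'' (ω + ψ') (EuclideanSpace.single z (1 : ℝ))
            (EuclideanSpace.single t (1 : ℝ)) ∂(multivariateGaussian 0 (A * Aᵀ))))) * (U' (ω + ψ') (EuclideanSpace.single s (1 : ℝ)) - ((∫ ω :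
            EuclideanSpace ℝ ι, exp (-U (ω + ψ')) ∂(multivariateGaussian 0 (A * Aᵀ)))⁻¹ * (∫ ω : EuclideanSpace ℝ ι, exp (-U (ω + ψ')) * U' (ω + ψ')
            (EuclideanSpace.single s (1 : ℝ)) ∂(multivariateGaussian 0 (A * Aᵀ)))))) ∂(multivariateGaussian 0 (A * Aᵀ))) + (∫ ω : EuclideanSpace ℝ ι,
            exp (-U (ω + ψ')) ∂(multivariateGaussian 0 (A * Aᵀ)))⁻¹ * (∫ ω : EuclideanSpace ℝ ι, exp (-U (ω + ψ')) * ((U' (ω + ψ')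
            (EuclideanSpace.single y (1 : ℝ)) - ((∫ ω : EuclideanSpace ℝ ι, exp (-U (ω + ψ')) ∂(multivariateGaussian 0 (A * Aᵀ)))⁻¹ * (∫ ω :
            EuclideanSpace ℝ ι, exp (-U (ω + ψ')) * U' (ω + ψ') (EuclideanSpace.single y (1 : ℝ)) ∂(multivariateGaussian 0 (A * Aᵀ))))) * (U'' (ω +
            ψ') (EuclideanSpace.single z (1 : ℝ)) (EuclideanSpace.single s (1 : ℝ)) - ((∫ ω : EuclideanSpace ℝ ι, exp (-U (ω + ψ'))
            ∂(multivariateGaussian 0 (A * Aᵀ)))⁻¹ * (∫ ω : EuclideanSpace ℝ ι, exp (-U (ω + ψ')) * U'' (ω + ψ') (EuclideanSpace.single z (1 : ℝ))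
            (EuclideanSpace.single s (1 : ℝ)) ∂(multivariateGaussian 0 (A * Aᵀ))))) * (U' (ω + ψ') (EuclideanSpace.single t (1 : ℝ)) - ((∫ ω :
            EuclideanSpace ℝ ι, exp (-U (ω + ψ')) ∂(multivariateGaussian 0 (A * Aᵀ)))⁻¹ * (∫ ω : EuclideanSpace ℝ ι, exp (-U (ω + ψ')) * U' (ω + ψ')
            (EuclideanSpace.single t (1 : ℝ)) ∂(multivariateGaussian 0 (A * Aᵀ)))))) ∂(multivariateGaussian 0 (A * Aᵀ))) + (∫ ω : EuclideanSpace ℝ ι,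
            exp (-U (ω + ψ')) ∂(multivariateGaussian 0 (A * Aᵀ)))⁻¹ * (∫ ω : EuclideanSpace ℝ ι, exp (-U (ω + ψ')) * ((U' (ω + ψ')
            (EuclideanSpace.single y (1 : ℝ)) - ((∫ ω : EuclideanSpace ℝ ι, exp (-U (ω + ψ')) ∂(multivariateGaussian 0 (A * Aᵀ)))⁻¹ * (∫ ω :
            EuclideanSpace ℝ ι, exp (-U (ω + ψ')) * U' (ω + ψ') (EuclideanSpace.single y (1 : ℝ)) ∂(multivariateGaussian 0 (A * Aᵀ))))) * (U'' (ω +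
            ψ') (EuclideanSpace.single t (1 : ℝ)) (EuclideanSpace.single s (1 : ℝ)) - ((∫ ω : EuclideanSpace ℝ ι, exp (-U (ω + ψ'))
            ∂(multivariateGaussian 0 (A * Aᵀ)))⁻¹ * (∫ ω : EuclideanSpace ℝ ι, exp (-U (ω + ψ')) * U'' (ω + ψ') (EuclideanSpace.single t (1 : ℝ))
            (EuclideanSpace.single s (1 : ℝ)) ∂(multivariateGaussian 0 (A * Aᵀ))))) * (U' (ω + ψ') (EuclideanSpace.single z (1 : ℝ)) - ((∫ ω :
            EuclideanSpace ℝ ι, exp (-U (ω + ψ')) ∂(multivariateGaussian 0 (A * Aᵀ)))⁻¹ * (∫ ω : EuclideanSpace ℝ ι, exp (-U (ω + ψ')) * U' (ω + ψ')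
            (EuclideanSpace.single z (1 : ℝ)) ∂(multivariateGaussian 0 (A * Aᵀ)))))) ∂(multivariateGaussian 0 (A * Aᵀ)))) -
        ((∫ ω : EuclideanSpace ℝ ι, exp (-U (ω + ψ')) ∂(multivariateGaussian 0 (A * Aᵀ)))⁻¹ * (∫ ω : EuclideanSpace ℝ ι, exp (-U (ω + ψ')) * ((U' (ω
            + ψ') (EuclideanSpace.single y (1 : ℝ)) - ((∫ ω : EuclideanSpace ℝ ι, exp (-U (ω + ψ')) ∂(multivariateGaussian 0 (A * Aᵀ)))⁻¹ * (∫ ω :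
            EuclideanSpace ℝ ι, exp (-U (ω + ψ')) * U' (ω + ψ') (EuclideanSpace.single y (1 : ℝ)) ∂(multivariateGaussian 0 (A * Aᵀ))))) * (U' (ω +
            ψ') (EuclideanSpace.single z (1 : ℝ)) - ((∫ ω : EuclideanSpace ℝ ι, exp (-U (ω + ψ')) ∂(multivariateGaussian 0 (A * Aᵀ)))⁻¹ * (∫ ω :
            EuclideanSpace ℝ ι, exp (-U (ω + ψ')) * U' (ω + ψ') (EuclideanSpace.single z (1 : ℝ)) ∂(multivariateGaussian 0 (A * Aᵀ))))) * (U' (ω +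
            ψ') (EuclideanSpace.single t (1 : ℝ)) - ((∫ ω : EuclideanSpace ℝ ι, exp (-U (ω + ψ')) ∂(multivariateGaussian 0 (A * Aᵀ)))⁻¹ * (∫ ω :
            EuclideanSpace ℝ ι, exp (-U (ω + ψ')) * U' (ω + ψ') (EuclideanSpace.single t (1 : ℝ)) ∂(multivariateGaussian 0 (A * Aᵀ))))) * (U' (ω +
            ψ') (EuclideanSpace.single s (1 : ℝ)) - ((∫ ω : EuclideanSpace ℝ ι, exp (-U (ω + ψ')) ∂(multivariateGaussian 0 (A * Aᵀ)))⁻¹ * (∫ ω :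
            EuclideanSpace ℝ ι, exp (-U (ω + ψ')) * U' (ω + ψ') (EuclideanSpace.single s (1 : ℝ)) ∂(multivariateGaussian 0 (A * Aᵀ))))))
            ∂(multivariateGaussian 0 (A * Aᵀ))) - ((∫ ω : EuclideanSpace ℝ ι, exp (-U (ω + ψ')) ∂(multivariateGaussian 0 (A * Aᵀ)))⁻¹ * (∫ ω :
            EuclideanSpace ℝ ι, exp (-U (ω + ψ')) * ((U' (ω + ψ') (EuclideanSpace.single y (1 : ℝ)) - ((∫ ω : EuclideanSpace ℝ ι, exp (-U (ω + ψ'))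
            ∂(multivariateGaussian 0 (A * Aᵀ)))⁻¹ * (∫ ω : EuclideanSpace ℝ ι, exp (-U (ω + ψ')) * U' (ω + ψ') (EuclideanSpace.single y (1 : ℝ))
            ∂(multivariateGaussian 0 (A * Aᵀ))))) * (U' (ω + ψ') (EuclideanSpace.single z (1 : ℝ)) - ((∫ ω : EuclideanSpace ℝ ι, exp (-U (ω + ψ'))
            ∂(multivariateGaussian 0 (A * Aᵀ)))⁻¹ * (∫ ω : EuclideanSpace ℝ ι, exp (-U (ω + ψ')) * U' (ω + ψ') (EuclideanSpace.single z (1 : ℝ))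
            ∂(multivariateGaussian 0 (A * Aᵀ)))))) ∂(multivariateGaussian 0 (A * Aᵀ)))) * ((∫ ω : EuclideanSpace ℝ ι, exp (-U (ω + ψ'))
            ∂(multivariateGaussian 0 (A * Aᵀ)))⁻¹ * (∫ ω : EuclideanSpace ℝ ι, exp (-U (ω + ψ')) * ((U' (ω + ψ') (EuclideanSpace.single t (1 : ℝ)) -
            ((∫ ω : EuclideanSpace ℝ ι, exp (-U (ω + ψ')) ∂(multivariateGaussian 0 (A * Aᵀ)))⁻¹ * (∫ ω : EuclideanSpace ℝ ι, exp (-U (ω + ψ')) * U'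
            (ω + ψ') (EuclideanSpace.single t (1 : ℝ)) ∂(multivariateGaussian 0 (A * Aᵀ))))) * (U' (ω + ψ') (EuclideanSpace.single s (1 : ℝ)) - ((∫ ω
            : EuclideanSpace ℝ ι, exp (-U (ω + ψ')) ∂(multivariateGaussian 0 (A * Aᵀ)))⁻¹ * (∫ ω : EuclideanSpace ℝ ι, exp (-U (ω + ψ')) * U' (ω +
            ψ') (EuclideanSpace.single s (1 : ℝ)) ∂(multivariateGaussian 0 (A * Aᵀ)))))) ∂(multivariateGaussian 0 (A * Aᵀ)))) - ((∫ ω :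
            EuclideanSpace ℝ ι, exp (-U (ω + ψ')) ∂(multivariateGaussian 0 (A * Aᵀ)))⁻¹ * (∫ ω : EuclideanSpace ℝ ι, exp (-U (ω + ψ')) * ((U' (ω +
            ψ') (EuclideanSpace.single y (1 : ℝ)) - ((∫ ω : EuclideanSpace ℝ ι, exp (-U (ω + ψ')) ∂(multivariateGaussian 0 (A * Aᵀ)))⁻¹ * (∫ ω :
            EuclideanSpace ℝ ι, exp (-U (ω + ψ')) * U' (ω + ψ') (EuclideanSpace.single y (1 : ℝ)) ∂(multivariateGaussian 0 (A * Aᵀ))))) * (U' (ω +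
            ψ') (EuclideanSpace.single t (1 : ℝ)) - ((∫ ω : EuclideanSpace ℝ ι, exp (-U (ω + ψ')) ∂(multivariateGaussian 0 (A * Aᵀ)))⁻¹ * (∫ ω :
            EuclideanSpace ℝ ι, exp (-U (ω + ψ')) * U' (ω + ψ') (EuclideanSpace.single t (1 : ℝ)) ∂(multivariateGaussian 0 (A * Aᵀ))))))
            ∂(multivariateGaussian 0 (A * Aᵀ)))) * ((∫ ω : EuclideanSpace ℝ ι, exp (-U (ω + ψ')) ∂(multivariateGaussian 0 (A * Aᵀ)))⁻¹ * (∫ ω :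
            EuclideanSpace ℝ ι, exp (-U (ω + ψ')) * ((U' (ω + ψ') (EuclideanSpace.single z (1 : ℝ)) - ((∫ ω : EuclideanSpace ℝ ι, exp (-U (ω + ψ'))
            ∂(multivariateGaussian 0 (A * Aᵀ)))⁻¹ * (∫ ω : EuclideanSpace ℝ ι, exp (-U (ω + ψ')) * U' (ω + ψ') (EuclideanSpace.single z (1 : ℝ))
            ∂(multivariateGaussian 0 (A * Aᵀ))))) * (U' (ω + ψ') (EuclideanSpace.single s (1 : ℝ)) - ((∫ ω : EuclideanSpace ℝ ι, exp (-U (ω + ψ'))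
            ∂(multivariateGaussian 0 (A * Aᵀ)))⁻¹ * (∫ ω : EuclideanSpace ℝ ι, exp (-U (ω + ψ')) * U' (ω + ψ') (EuclideanSpace.single s (1 : ℝ))
            ∂(multivariateGaussian 0 (A * Aᵀ)))))) ∂(multivariateGaussian 0 (A * Aᵀ)))) - ((∫ ω : EuclideanSpace ℝ ι, exp (-U (ω + ψ'))
            ∂(multivariateGaussian 0 (A * Aᵀ)))⁻¹ * (∫ ω : EuclideanSpace ℝ ι, exp (-U (ω + ψ')) * ((U' (ω + ψ') (EuclideanSpace.single y (1 : ℝ)) -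
            ((∫ ω : EuclideanSpace ℝ ι, exp (-U (ω + ψ')) ∂(multivariateGaussian 0 (A * Aᵀ)))⁻¹ * (∫ ω : EuclideanSpace ℝ ι, exp (-U (ω + ψ')) * U'
            (ω + ψ') (EuclideanSpace.single y (1 : ℝ)) ∂(multivariateGaussian 0 (A * Aᵀ))))) * (U' (ω + ψ') (EuclideanSpace.single s (1 : ℝ)) - ((∫ ω
            : EuclideanSpace ℝ ι, exp (-U (ω + ψ')) ∂(multivariateGaussian 0 (A * Aᵀ)))⁻¹ * (∫ ω : EuclideanSpace ℝ ι, exp (-U (ω + ψ')) * U' (ω +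
            ψ') (EuclideanSpace.single s (1 : ℝ)) ∂(multivariateGaussian 0 (A * Aᵀ)))))) ∂(multivariateGaussian 0 (A * Aᵀ)))) * ((∫ ω :
            EuclideanSpace ℝ ι, exp (-U (ω + ψ')) ∂(multivariateGaussian 0 (A * Aᵀ)))⁻¹ * (∫ ω : EuclideanSpace ℝ ι, exp (-U (ω + ψ')) * ((U' (ω +
            ψ') (EuclideanSpace.single z (1 : ℝ)) - ((∫ ω : EuclideanSpace ℝ ι, exp (-U (ω + ψ')) ∂(multivariateGaussian 0 (A * Aᵀ)))⁻¹ * (∫ ω :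
            EuclideanSpace ℝ ι, exp (-U (ω + ψ')) * U' (ω + ψ') (EuclideanSpace.single z (1 : ℝ)) ∂(multivariateGaussian 0 (A * Aᵀ))))) * (U' (ω +
            ψ') (EuclideanSpace.single t (1 : ℝ)) - ((∫ ω : EuclideanSpace ℝ ι, exp (-U (ω + ψ')) ∂(multivariateGaussian 0 (A * Aᵀ)))⁻¹ * (∫ ω :
            EuclideanSpace ℝ ι, exp (-U (ω + ψ')) * U' (ω + ψ') (EuclideanSpace.single t (1 : ℝ)) ∂(multivariateGaussian 0 (A * Aᵀ))))))
            ∂(multivariateGaussian 0 (A * Aᵀ)))))) ψ (EuclideanSpace.single x (1 : ℝ))| ≤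
      κ₅r + (4 * (αr * k5r * (αc * hc)) + hr * αr * (αc * k5c) + 6 * (αr * k4r * (αc * k3c)) + 4 * (αr * k3r * (αc * k4c))) * dθ * dθ' / (1 - lamA) +
        10 * (n₃ * ((4 * Real.sqrt ((5 * ((κ₂ ^ 4 + κ₄ ^ 4) * γop ^ 2) / (1 - lam * γop) ^ 2) * (αθ * dθ * (αθ * dθ') / (1 - lamA)))) * S ^ 2)) +
        15 * ((n : ℝ) * n * ((4 * Real.sqrt ((5 * ((κ₂ ^ 4 + κ₃ ^ 4) * γop ^ 2) / (1 - lam * γop) ^ 2) * (αθ * dθ * (αθ * dθ') / (1 - lamA)))) * S ^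
            2)) +
        10 * (n * ((4 * (αθ * dθ * (αθ * dθ') / (1 - lamA)) + 3 * (αθ * dθ * (αθ * dθ') / (1 - lamA)) ^ 2 + 4 * (5 * ((κ₂ ^ 4 + κ₃ ^ 4) * γop ^ 2) /
            (1 - lam * γop) ^ 2) + 4 * (50 * ((κ₂ ^ 6 + κ₃ ^ 6) * γop ^ 3) / (1 - lam * γop) ^ 3) + 2 * (((5 * ((κ₂ ^ 4 + κ₃ ^ 4) * γop ^ 2) / (1 -
            lam * γop) ^ 2) + 1) / 2) * ((((5 * ((κ₂ ^ 4 + κ₃ ^ 4) * γop ^ 2) / (1 - lam * γop) ^ 2) + 1) / 2) + (5 * ((κ₂ ^ 4 + κ₃ ^ 4) * γop ^ 2) /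
            (1 - lam * γop) ^ 2))) * (16 * S' ^ 3))) +
        ((4 * (αθ * dθ * (αθ * dθ') / (1 - lamA)) + 5 * (50 * (κ₂ ^ 6 * γop ^ 3) / (1 - lam * γop) ^ 3) + (((5 * (κ₂ ^ 4 * γop ^ 2) / (1 - lam * γop)
            ^ 2) + 1) / 2) * (5 * (κ₂ ^ 4 * γop ^ 2) / (1 - lam * γop) ^ 2) + 2 * (αθ * dθ * (αθ * dθ') / (1 - lamA)) * ((((5 * (κ₂ ^ 4 * γop ^ 2) /
            (1 - lam * γop) ^ 2) + 1) / 2) + (5 * (κ₂ ^ 4 * γop ^ 2) / (1 - lam * γop) ^ 2)) + 24 * (((5 * (κ₂ ^ 4 * γop ^ 2) / (1 - lam * γop) ^ 2)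
            + 1) / 2) * Real.sqrt ((αθ * dθ * (αθ * dθ') / (1 - lamA)) * (5 * (κ₂ ^ 4 * γop ^ 2) / (1 - lam * γop) ^ 2))) + (6 * (αθ * dθ * (αθ *
            dθ') / (1 - lamA)) + 5 * (50 * (κ₂ ^ 6 * γop ^ 3) / (1 - lam * γop) ^ 3) + ((((5 * (κ₂ ^ 4 * γop ^ 2) / (1 - lam * γop) ^ 2) + 1) / 2) +
            (5 * (κ₂ ^ 4 * γop ^ 2) / (1 - lam * γop) ^ 2)) ^ 2 / 2 + 3 * (((5 * (κ₂ ^ 4 * γop ^ 2) / (1 - lam * γop) ^ 2) + 1) / 2) * (5 * (κ₂ ^ 4 *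
            γop ^ 2) / (1 - lam * γop) ^ 2) + 3 * (αθ * dθ * (αθ * dθ') / (1 - lamA)) * ((((5 * (κ₂ ^ 4 * γop ^ 2) / (1 - lam * γop) ^ 2) + 1) / 2) +
            (5 * (κ₂ ^ 4 * γop ^ 2) / (1 - lam * γop) ^ 2)) + 12 * (((5 * (κ₂ ^ 4 * γop ^ 2) / (1 - lam * γop) ^ 2) + 1) / 2) * Real.sqrt ((αθ * dθ *
            (αθ * dθ') / (1 - lamA)) * (5 * (κ₂ ^ 4 * γop ^ 2) / (1 - lam * γop) ^ 2)))) * (576 * S₁ ^ 4) := by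
  haveI : Nonempty ι := ⟨x⟩
  have hl1 : 0 < 1 - lamA := by linarith
  have hαr0 : 0 ≤ αr := (Finset.sum_nonneg fun w _ => abs_nonneg (A x w)).trans (hαr x)
  have hhr0 : 0 ≤ hr := (Finset.sum_nonneg fun u _ => hHk0 x u).trans (hhr x)
  have hk3e0 : 0 ≤ k3e := (Finset.sum_nonneg fun u _ => hK30 x x u).trans (hk3e x x)
  have hk4e0 : 0 ≤ k4e := (Finset.sum_nonneg fun u _ => hK40 x x x u).trans (hk4e x x x)
  have hA1 : 0 ≤ Real.exp (8 * μ * (R + R')) * (hr * αr) := mul_nonneg (Real.exp_pos _).le (mul_nonneg hhr0 hαr0)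
  have hA2 : 0 ≤ Real.exp (8 * μ * (R + R₃)) * (αr * k3e) := mul_nonneg (Real.exp_pos _).le (mul_nonneg hαr0 hk3e0)
  have hA3 : 0 ≤ Real.exp (8 * μ * (R + R₄)) * (αr * k4e) := mul_nonneg (Real.exp_pos _).le (mul_nonneg hαr0 hk4e0)
  have hβ0 : 0 ≤ αθ := (add_nonneg (add_nonneg hA1 hA2) hA3).trans hαθ
  have hP1 : Real.exp (8 * μ * (R + R')) * (hr * αr) ≤ αθ :=
    ((le_add_of_nonneg_right hA2).trans (le_add_of_nonneg_right hA3)).trans hαθ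
  have hP2 : Real.exp (8 * μ * (R + R₃)) * (αr * k3e) ≤ αθ :=
    ((le_add_of_nonneg_left hA1).trans (le_add_of_nonneg_right hA3)).trans hαθ
  have hP3 : Real.exp (8 * μ * (R + R₄)) * (αr * k4e) ≤ αθ :=
    (le_add_of_nonneg_left (add_nonneg hA1 hA2)).trans hαθ
  -- the weights `θ`: `≥ 1`, diagonal `1`, submultiplicative ((476))
  have hθw1 : ∀ z w : κ, 1 ≤ (fun z w : κ => Real.exp (8 * μ * dist (q z) (q w))) z w := fun z w => expw_one_le (by linarith) (q z) (q w)
  have hθdiag : ∀ z : κ, (fun z w : κ => Real.exp (8 * μ * dist (q z) (q w))) z z = 1 := fun z => by simp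
  have hθmul : ∀ z y w : κ, (fun z w : κ => Real.exp (8 * μ * dist (q z) (q w))) z w ≤ (fun z w : κ => Real.exp (8 * μ * dist (q z) (q w))) z y *
      (fun z w : κ => Real.exp (8 * μ * dist (q z) (q w))) y w := fun z y w => expw_triangle (by linarith) (q z) (q y) (q w)
  -- the Neumann `D` and its letters ((485)); plain sums from weighted sums since `θ ≥ 1`
  have hCθ := fun z => weighted_cross_rowsum_le hHk0 hαr hαc hhr hμ hAR hHkR hlamA1 z
  have hCθc := fun w => weighted_cross_colsum_le hHk0 hαr hαc hhc hμ hAR hHkR hlamA1 w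
  have hD := neumannD_nonneg (A := A) hHk0 hlamA1
  have hDC := neumannD_dominates (A := A) hHk0 hlamA1 hθw1 hCθ hγθ1
  have hDθr := neumannD_weighted_rowsum (A := A) hHk0 hlamA1 hθw1 hθdiag hθmul hCθ hγθ1
  have hDθc := neumannD_weighted_colsum (A := A) hHk0 hlamA1 hθw1 hθdiag hθmul hCθc hγθ'1
  have hDr : ∀ z, ∑ w, (fun x y : κ => ∑' n : ℕ, ((Matrix.of fun x w : κ => (if w = x then 0 else ∑ u, ∑ v, |A u w| * |A v x| * Hk v u) / (1 - lamA))
      ^ n) x y) z w ≤ (1 - (Real.exp (8 * μ * (2 * R + R')) * (αc * hr * αr) / (1 - lamA)))⁻¹ := fun z =>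
    (Finset.sum_le_sum fun w _ => le_mul_of_one_le_right (hD z w) (hθw1 z w)).trans (hDθr z)
  have hDc : ∀ w, ∑ z, (fun x y : κ => ∑' n : ℕ, ((Matrix.of fun x w : κ => (if w = x then 0 else ∑ u, ∑ v, |A u w| * |A v x| * Hk v u) / (1 - lamA))
      ^ n) x y) z w ≤ (1 - (Real.exp (8 * μ * (2 * R + R')) * (αc * hc * αr) / (1 - lamA)))⁻¹ := fun w =>
    (Finset.sum_le_sum fun z _ => le_mul_of_one_le_right (hD z w) (hθw1 z w)).trans (hDθc w)
  have hdθ0 : 0 ≤ dθ := (inv_nonneg.2 (by linarith)).trans hdθ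
  have hdθ0' : 0 ≤ dθ' := (inv_nonneg.2 (by linarith)).trans hdθ'
  -- the `r`-site letter in the other direction (symmetry of `dist`)
  have hSc : ∀ v, ∑ u, ((fun x y : ι => Real.exp (μ / 3 * dist (p x) (p y))) u v ^ 2)⁻¹ ≤ S' := fun v => by
    have h := hS' v
    simp_rw [dist_comm (p v)] at h
    exact h
  exact whitened_fifth_kernel_letter (θ := (fun z w : κ => Real.exp (8 * μ * dist (q z) (q w)))) (σ := (fun x w => Real.exp (8 * μ * dist (p x) (q
      w)))) (ρ := (fun x y : ι => Real.exp (μ * dist (p x) (p y)))) (r := (fun x y : ι => Real.exp (μ / 3 * dist (p x) (p y)))) (D := (fun x y : κ =>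
      ∑' n : ℕ, ((Matrix.of fun x w : κ => (if w = x then 0 else ∑ u, ∑ v, |A u w| * |A v x| * Hk v u) / (1 - lamA)) ^ n) x y))
    hΓop Y hUd hU'd hU''d hU₃d hU₄d hU₅c hκ₀ hκ₁ ha hτ hδ hθ0 hθ1 hκθ hκθw hstab hU'b hU''b hU₃b hU₄b hU₅b hlam hUsec hρg hHk hHk0 hK3 hK30 hK4 hK40
        hK5 hK50 hU₅row hhr hhc hk3r hk3c hk4r hk4c hk5r hk5c ψ hαr hαc hlamA hlamA1 hγ hγ1 hD hDC (fun z => (hDr z).trans hdθ) (fun w => (hDc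
        w).trans hdθ') (fun z w => (Real.exp_pos _).le) (fun z => (hDθr z).trans hdθ) hdθ0 (fun w => (hDθc w).trans hdθ') hdθ0' (fun x w =>
        (Real.exp_pos _).le) (fun x z w => sigma_theta hμ p q x z w) (fun x y => expw_one_le hμ (p x) (p y)) (fun x y => by rw [dist_comm]) (fun x y
        z => expw_triangle hμ (p x) (p y) (p z)) (fun x y w => rho_pow_eight_le hμ p q x y w) (fun x y => expw_one_le (by linarith) (p x) (p y)) (fun
        u v => by rw [dist_comm]) (fun x y w => r_pow_24_le hμ p q x y w) (fun v => (weighted_obs_rowsum_le hHk0 hαr hhr hμ hAR hHkR v).trans hP1)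
        hβ0 (fun v w => (weighted_obs_entry_le hHk0 hαr hhr hμ hAR hHkR v w).trans hP1) (fun x y => (weighted_hess_rowsum_le hK30 hαr hk3e hμ hAR
        hK3R x y).trans hP2) (fun x y w => (weighted_hess_entry_le hK30 hαr hk3e hμ hAR hK3R x y w).trans hP2) (fun x y z =>
        (weighted_third4_rowsum_le hK40 hαr hk4e hμ hAR hK4R x y z).trans hP3) (fun x y z w => (weighted_third4_entry_le hK40 hαr hk4e hμ hAR hK4R x
        y z w).trans hP3) x hS hS' hSc hS1 hn hn3

end TheEnd

/-- Toy (one profile letter for three profiles): the middle of three non-negative terms is below their sum. -/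
example (a b c : ℝ) (ha : 0 ≤ a) (hc : 0 ≤ c) : b ≤ a + b + c := by linarith

end Summit.QuantumFields.BalabanUV.T4Continuum.NE7b.SupFiniteRangeFifthKernelLetter

end
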